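import Summits.RiemannHypothesis.RiemannHypothesis.Theorems.JensenPolynomialsXiGorttwCoeffSmallTableAlgebra

/-!
# Route `JensenPolynomials` — TABLE crux, part 2: the exact-ℚ interval checker and its soundness

Kernel packaging of the TABLE crux `XiGorttwCoeffSmallBelow rhoWinMin 10000` (rung J-P(P1′), RH-FREE proof-of-data),
part 2. A cell `(d, n)` of the crux reads the `d` consecutive-ratio boxes `ρ_m ∋ γ(m+1)/γ(m)`, `n ≤ m < n + d`.
From them the COMPUTABLE function `checkCell` encloses, in exact rational arithmetic with outward rounding to the
grid `10^{-64}`, the window ratios `w_i` (part 1), `Δ² = (1 − w_2)/2`, the scaled coefficients `S_k` and the scaled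
Hermite coordinates `T_j = c_{d,n,j}·Δ^j`, and decides
`Σ_{j=1}^{d} |c_{d,n,j}|·R(d,j) < 1` and `Σ_{j=1}^{d} |c_{d,n,j}|·t_d^j < 1` by the parity split
`E + O/Δ ≤ E + O/√δ < 1 ⟸ E < 1 ∧ O² < (1−E)²δ` (`δ ≤ Δ²` the lower end of the `Δ²` box), where `R(d,j)`,
`t_d` are any rationals with `rhoHT d j ≤ R(d,j)` and `2/B_d ≤ t_d` (validity predicates `RValid`, `TValid`,
decidable). MAIN RESULT `cellSmall_of_checkCell`: for ANY real `γ` enclosed by the boxes, `checkCell = true` (with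
valid tables, `3 ≤ d < 108`) implies the cell inequality of `XiGorttwCoeffSmallBelow rhoWinMin` at `(d, n)`
(`rhoWinMin ≤ rhoHT` below `d = 108`). Interval lemmas follow Moore's inclusion-monotonicity [Moore1979, Ch. 3];
pattern of the tree's `JensenCoeffBox` (`JensenShiftCertificate.lean`). Nothing here bears on the truth of RH.
-/

-- D-0017: `Summit.RiemannHypothesis.RiemannHypothesis.…` duplicates the namespace BY DESIGN (single-problem summit).
set_option linter.dupNamespace false

namespace Summit.RiemannHypothesis.RiemannHypothesis.Theorems.JensenPolynomials.CoeffTable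

open Literature.NumberTheory.LFunctions Polynomial Finset
open scoped BigOperators Nat

/-! ## Rational intervals with outward rounding -/

/-- An interval is a pair `(lo, hi)` of rationals. -/
abbrev Iv := ℚ × ℚ

/-- Grid `10⁶⁴` for outward rounding (keeps numerators/denominators small). -/
def grid : ℚ := (10 : ℚ) ^ 64

/-- Round down to the grid. -/
def floorG (x : ℚ) : ℚ := (⌊x * grid⌋ : ℚ) / grid
/-- Round up to the grid. -/
def ceilG (x : ℚ) : ℚ := (⌈x * grid⌉ : ℚ) / grid

/-- `x ∈ I` for a real `x`. -/
def Mem (x : ℝ) (I : Iv) : Prop := ((I.1 : ℚ) : ℝ) ≤ x ∧ x ≤ ((I.2 : ℚ) : ℝ)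

/-- Product of two intervals with nonnegative lower ends. -/
def mulPos (a b : Iv) : Iv := (floorG (a.1 * b.1), ceilG (a.2 * b.2))
/-- Quotient `a / b` for `a` with nonnegative lower end and `b` with positive lower end. -/
def divPos (a b : Iv) : Iv := (floorG (a.1 / b.2), ceilG (a.2 / b.1))
/-- Exact scaling by an integer. -/
def scaleInt (c : ℤ) (a : Iv) : Iv :=
  if 0 ≤ c then ((c : ℚ) * a.1, (c : ℚ) * a.2) else ((c : ℚ) * a.2, (c : ℚ) * a.1)
/-- Product of an interval `p` with nonnegative lower end by an arbitrary interval `s`. -/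
def mulNS (p s : Iv) : Iv :=
  (floorG (if 0 ≤ s.1 then p.1 * s.1 else p.2 * s.1), ceilG (if 0 ≤ s.2 then p.2 * s.2 else p.1 * s.2))
/-- Upper bound of `|x|` on the interval. -/
def absUb (a : Iv) : ℚ := max |a.1| |a.2|
/-- Sum of intervals over a finite set (exact). -/
def ivSum (s : Finset ℕ) (f : ℕ → Iv) : Iv := (∑ l ∈ s, (f l).1, ∑ l ∈ s, (f l).2)

/-- The grid is positive. -/
theorem grid_pos : (0 : ℚ) < grid := by unfold grid; positivity

/-- Rounding down does not increase. -/
theorem floorG_le (x : ℚ) : floorG x ≤ x := by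
  unfold floorG; rw [div_le_iff₀ grid_pos]; exact Int.floor_le _

/-- Rounding up does not decrease. -/
theorem le_ceilG (x : ℚ) : x ≤ ceilG x := by
  unfold ceilG; rw [le_div_iff₀ grid_pos]; exact Int.le_ceil _

/-- A real below-bound survives rounding down. -/
theorem floorG_le_real {x : ℚ} {y : ℝ} (h : (x : ℝ) ≤ y) : ((floorG x : ℚ) : ℝ) ≤ y :=
  le_trans (by exact_mod_cast floorG_le x) h

/-- A real above-bound survives rounding up. -/
theorem real_le_ceilG {x : ℚ} {y : ℝ} (h : y ≤ (x : ℝ)) : y ≤ ((ceilG x : ℚ) : ℝ) :=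
  le_trans h (by exact_mod_cast le_ceilG x)

/-- Interval product is inclusion-monotone for nonnegative factors [Moore1979, Ch. 3]. -/
theorem mem_mulPos {a b : Iv} {x y : ℝ} (ha : 0 ≤ a.1) (hb : 0 ≤ b.1) (hx : Mem x a) (hy : Mem y b) :
    Mem (x * y) (mulPos a b) := by
  obtain ⟨hx1, hx2⟩ := hx; obtain ⟨hy1, hy2⟩ := hy
  have ha' : (0 : ℝ) ≤ (a.1 : ℝ) := by exact_mod_cast ha
  have hb' : (0 : ℝ) ≤ (b.1 : ℝ) := by exact_mod_cast hb
  constructor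
  · apply floorG_le_real; push_cast
    exact mul_le_mul hx1 hy1 hb' (ha'.trans hx1)
  · apply real_le_ceilG; push_cast
    exact mul_le_mul hx2 hy2 (hb'.trans hy1) ((ha'.trans hx1).trans hx2)

/-- Interval quotient is inclusion-monotone (nonnegative numerator, positive denominator) [Moore1979, Ch. 3]. -/
theorem mem_divPos {a b : Iv} {x y : ℝ} (ha : 0 ≤ a.1) (hb : 0 < b.1) (hx : Mem x a) (hy : Mem y b) :
    Mem (x / y) (divPos a b) := by
  obtain ⟨hx1, hx2⟩ := hx; obtain ⟨hy1, hy2⟩ := hy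
  have ha' : (0 : ℝ) ≤ (a.1 : ℝ) := by exact_mod_cast ha
  have hb' : (0 : ℝ) < (b.1 : ℝ) := by exact_mod_cast hb
  have hy0 : 0 < y := lt_of_lt_of_le hb' hy1
  have hx0 : 0 ≤ x := ha'.trans hx1
  constructor
  · apply floorG_le_real; push_cast
    calc (a.1 : ℝ) / (b.2 : ℝ) ≤ x / (b.2 : ℝ) := div_le_div_of_nonneg_right hx1 (hy0.le.trans hy2)
      _ ≤ x / y := div_le_div_of_nonneg_left hx0 hy0 hy2
  · apply real_le_ceilG; push_cast
    calc x / y ≤ (a.2 : ℝ) / y := div_le_div_of_nonneg_right hx2 hy0.le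
      _ ≤ (a.2 : ℝ) / (b.1 : ℝ) := div_le_div_of_nonneg_left (hx0.trans hx2) hb' hy1

/-- Exact integer scaling of an interval. -/
theorem mem_scaleInt (c : ℤ) {a : Iv} {x : ℝ} (hx : Mem x a) : Mem ((c : ℝ) * x) (scaleInt c a) := by
  obtain ⟨hx1, hx2⟩ := hx
  unfold scaleInt
  split_ifs with hc
  · have hc' : (0 : ℝ) ≤ (c : ℝ) := by exact_mod_cast hc
    constructor <;> push_cast
    · exact mul_le_mul_of_nonneg_left hx1 hc'
    · exact mul_le_mul_of_nonneg_left hx2 hc'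
  · have hc' : (c : ℝ) ≤ 0 := by exact_mod_cast (not_le.mp hc).le
    constructor <;> push_cast
    · exact mul_le_mul_of_nonpos_left hx2 hc'
    · exact mul_le_mul_of_nonpos_left hx1 hc'

/-- Product of a nonnegative interval by a signed interval encloses the product. -/
theorem mem_mulNS {p s : Iv} {x y : ℝ} (hp : 0 ≤ p.1) (hx : Mem x p) (hy : Mem y s) :
    Mem (x * y) (mulNS p s) := by
  obtain ⟨hx1, hx2⟩ := hx; obtain ⟨hy1, hy2⟩ := hy
  have hp' : (0 : ℝ) ≤ (p.1 : ℝ) := by exact_mod_cast hp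
  have hx0 : 0 ≤ x := hp'.trans hx1
  unfold mulNS
  constructor
  · apply floorG_le_real
    split_ifs with hs
    · have hs' : (0 : ℝ) ≤ (s.1 : ℝ) := by exact_mod_cast hs
      push_cast
      calc (p.1 : ℝ) * (s.1 : ℝ) ≤ x * (s.1 : ℝ) := mul_le_mul_of_nonneg_right hx1 hs'
        _ ≤ x * y := mul_le_mul_of_nonneg_left hy1 hx0
    · have hs' : (s.1 : ℝ) ≤ 0 := by exact_mod_cast (not_le.mp hs).le
      push_cast
      calc (p.2 : ℝ) * (s.1 : ℝ) ≤ x * (s.1 : ℝ) := mul_le_mul_of_nonpos_right hx2 hs'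
        _ ≤ x * y := mul_le_mul_of_nonneg_left hy1 hx0
  · apply real_le_ceilG
    split_ifs with hs
    · have hs' : (0 : ℝ) ≤ (s.2 : ℝ) := by exact_mod_cast hs
      push_cast
      calc x * y ≤ x * (s.2 : ℝ) := mul_le_mul_of_nonneg_left hy2 hx0
        _ ≤ (p.2 : ℝ) * (s.2 : ℝ) := mul_le_mul_of_nonneg_right hx2 hs'
    · have hs' : (s.2 : ℝ) ≤ 0 := by exact_mod_cast (not_le.mp hs).le
      push_cast
      calc x * y ≤ x * (s.2 : ℝ) := mul_le_mul_of_nonneg_left hy2 hx0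
        _ ≤ (p.1 : ℝ) * (s.2 : ℝ) := mul_le_mul_of_nonpos_right hx1 hs'

/-- `|x|` is bounded by `absUb` on the interval. -/
theorem abs_le_absUb {a : Iv} {x : ℝ} (hx : Mem x a) : |x| ≤ ((absUb a : ℚ) : ℝ) := by
  obtain ⟨hx1, hx2⟩ := hx
  unfold absUb
  push_cast
  rw [abs_le]
  constructor
  · have : -(|(a.1 : ℝ)|) ≤ (a.1 : ℝ) := neg_abs_le _
    have h2 : |(a.1 : ℝ)| ≤ max |(a.1 : ℝ)| |(a.2 : ℝ)| := le_max_left _ _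
    linarith
  · exact le_trans (le_trans hx2 (le_abs_self _)) (le_max_right _ _)

/-- Termwise enclosures sum to an enclosure of the sum. -/
theorem mem_ivSum {s : Finset ℕ} {f : ℕ → Iv} {x : ℕ → ℝ} (h : ∀ l ∈ s, Mem (x l) (f l)) :
    Mem (∑ l ∈ s, x l) (ivSum s f) := by
  unfold ivSum
  constructor
  · push_cast; exact Finset.sum_le_sum fun l hl => (h l hl).1
  · push_cast; exact Finset.sum_le_sum fun l hl => (h l hl).2

/-- A rational is enclosed by its point interval. -/
theorem mem_const (q : ℚ) : Mem (q : ℝ) (q, q) := ⟨le_rfl, le_rfl⟩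

/-- The lower end of `mulPos` is nonnegative when the factors' are. -/
theorem mulPos_fst_nonneg {a b : Iv} (ha : 0 ≤ a.1) (hb : 0 ≤ b.1) : 0 ≤ (mulPos a b).1 := by
  unfold mulPos floorG
  apply div_nonneg _ grid_pos.le
  exact_mod_cast Int.floor_nonneg.mpr (mul_nonneg (mul_nonneg ha hb) grid_pos.le)

/-- The lower end of `divPos` is nonnegative (nonnegative numerator end, nonnegative denominator end). -/
theorem divPos_fst_nonneg {a b : Iv} (ha : 0 ≤ a.1) (hb : 0 ≤ b.2) : 0 ≤ (divPos a b).1 := by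
  unfold divPos floorG
  apply div_nonneg _ grid_pos.le
  exact_mod_cast Int.floor_nonneg.mpr (mul_nonneg (div_nonneg ha hb) grid_pos.le)

/-! ## The cell checker -/

/-- Window-ratio boxes `W_0, …` from the cell's window `win t ∋ γ(n+t+1)/γ(n+t)`, `t < d`:
`W_0 = [1,1]`, `W_{i+1} = W_i · win(d−1) / win(d−1−i)` (the recurrence `wR_succ`). -/
def wIv (win : ℕ → Iv) (d : ℕ) : ℕ → Iv
  | 0 => (1, 1)
  | i + 1 => divPos (mulPos (wIv win d i) (win (d - 1))) (win (d - 1 - i))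

/-- The memoised list `[W_0, …, W_d]`. -/
def wList (win : ℕ → Iv) (d : ℕ) : List Iv := (List.range (d + 1)).map (wIv win d)

/-- The table `[[sCoef d l k]_k]_l` (computed ONCE per degree; `Nat.choose` is Pascal-recursive). -/
def sTab (d : ℕ) : List (List ℤ) :=
  (List.range (d + 1)).map fun l => (List.range (d + 1)).map fun k => sCoef d l k

/-- Lookup in an integer table (default `0`). -/
def lkz (T : List (List ℤ)) (l k : ℕ) : ℤ := (T.getD l []).getD k 0

/-- Box for `S_k` from a lookup `W` of the window-ratio boxes and a coefficient table `T` (= `sTab d`). -/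
def sIv (d : ℕ) (T : List (List ℤ)) (W : ℕ → Iv) (k : ℕ) : Iv :=
  ivSum (range (d + 1)) fun l => if k ≤ l then scaleInt (lkz T l k) (W (d - l)) else (0, 0)

/-- Box for `(Δ²)^i`. -/
def dPow (D : Iv) : ℕ → Iv
  | 0 => (1, 1)
  | i + 1 => mulPos (dPow D i) D

/-- Box for `T_j` from lookups `S` (boxes of `S_k`) and `Dp` (boxes of `(Δ²)^i`). -/
def tIv (d : ℕ) (S : ℕ → Iv) (Dp : ℕ → Iv) (j : ℕ) : Iv :=
  ivSum (range (j / 2 + 1)) fun i =>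
    mulNS ((Dp i).1 * qCoef d j i, (Dp i).2 * qCoef d j i) (S (d - j + 2 * i))

/-- `E`-part of a weighted sum: even indices `j = 2, 4, …`. -/
def ePart (d : ℕ) (U : ℕ → ℚ) (wt : ℕ → ℚ) (δ : ℚ) : ℚ :=
  ∑ j ∈ range d, if (j + 1) % 2 = 0 then U (j + 1) * wt (j + 1) / δ ^ ((j + 1) / 2) else 0
/-- `O`-part of a weighted sum: odd indices `j = 1, 3, …`. -/
def oPart (d : ℕ) (U : ℕ → ℚ) (wt : ℕ → ℚ) (δ : ℚ) : ℚ :=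
  ∑ j ∈ range d, if (j + 1) % 2 = 0 then 0 else U (j + 1) * wt (j + 1) / δ ^ ((j + 1) / 2)

/-- The parity test `E < 1 ∧ O² < (1 − E)²·δ`. -/
def eoTest (d : ℕ) (U : ℕ → ℚ) (wt : ℕ → ℚ) (δ : ℚ) : Bool :=
  decide (ePart d U wt δ < 1) && decide (oPart d U wt δ ^ 2 < (1 - ePart d U wt δ) ^ 2 * δ)

/-- Lookup in a list of boxes (default `(0,0)`). -/
def lk (L : List Iv) (i : ℕ) : Iv := L.getD i (0, 0)

/-- **The cell checker.** Inputs: degree `d`, table row `R : ℕ → ℚ` (upper bounds of `rhoHT d ·`), `t : ℚ`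
(upper bound of `2/B_d`), the coefficient table `T` (meant to be `sTab d`), and the window `win` (a list of `d`
ratio boxes). -/
def checkCell (d : ℕ) (R : ℕ → ℚ) (t : ℚ) (T : List (List ℤ)) (win : List Iv) : Bool :=
  decide (win.length = d) &&
  (win.all fun b => decide (0 < b.1)) &&
  (let W := wList (lk win) d
   let D : Iv := ((1 - (lk W 2).2) / 2, (1 - (lk W 2).1) / 2)
   decide (0 < D.1) &&
   (let S := (List.range (d + 1)).map (sIv d T (lk W))
    let Dp := (List.range (d / 2 + 1)).map (dPow D)
    let U := (List.range (d + 1)).map fun j => absUb (tIv d (lk S) (lk Dp) j)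
    eoTest d (fun j => (lk' U j)) R D.1 && eoTest d (fun j => lk' U j) (fun j => t ^ j) D.1))
where
  /-- lookup in a list of rationals -/
  lk' (L : List ℚ) (i : ℕ) : ℚ := L.getD i 0

/-! ## The parity split -/

/-- The odd part is nonnegative for nonnegative data. -/
theorem oPart_nonneg {d : ℕ} {U wt : ℕ → ℚ} {δ : ℚ} (hU : ∀ j, j < d → 0 ≤ U (j + 1))
    (hwt : ∀ j, j < d → 0 ≤ wt (j + 1)) (hδ : 0 < δ) : 0 ≤ oPart d U wt δ := by
  unfold oPart
  refine Finset.sum_nonneg fun j hj => ?_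
  have hj' := mem_range.mp hj
  split_ifs
  · exact le_rfl
  · exact div_nonneg (mul_nonneg (hU _ hj') (hwt _ hj')) (pow_nonneg hδ.le _)

/-- The parity bound: `Σ_{j<d} U_{j+1} w_{j+1} / Δ^{j+1} ≤ E + O/Δ` when `0 < δ ≤ Δ²`. -/
theorem sum_le_ePart_add_oPart {d : ℕ} {U wt : ℕ → ℚ} {δ : ℚ} {Δ : ℝ} (hU : ∀ j, j < d → 0 ≤ U (j + 1))
    (hwt : ∀ j, j < d → 0 ≤ wt (j + 1)) (hδ : 0 < δ) (hΔ : 0 < Δ) (hδΔ : (δ : ℝ) ≤ Δ ^ 2) :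
    ∑ j ∈ range d, (U (j + 1) : ℝ) * (wt (j + 1) : ℝ) / Δ ^ (j + 1) ≤
      (ePart d U wt δ : ℝ) + (oPart d U wt δ : ℝ) / Δ := by
  unfold ePart oPart
  push_cast
  rw [Finset.sum_div, ← Finset.sum_add_distrib]
  refine Finset.sum_le_sum fun j hj => ?_
  have hj' := mem_range.mp hj
  have hUw : (0 : ℝ) ≤ (U (j + 1) : ℝ) * (wt (j + 1) : ℝ) :=
    mul_nonneg (by exact_mod_cast hU _ hj') (by exact_mod_cast hwt _ hj')
  have hδ' : (0 : ℝ) < (δ : ℝ) := by exact_mod_cast hδ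
  set a := (j + 1) / 2 with ha
  have hδa : (δ : ℝ) ^ a ≤ (Δ ^ 2) ^ a := pow_le_pow_left₀ hδ'.le hδΔ a
  split_ifs with hpar
  · -- even: j + 1 = 2a
    have hj : j + 1 = 2 * a := by omega
    push_cast
    rw [zero_div, add_zero, show Δ ^ (j + 1) = (Δ ^ 2) ^ a by rw [hj, pow_mul]]
    exact div_le_div_of_nonneg_left hUw (pow_pos hδ' a) hδa
  · -- odd: j + 1 = 2a + 1
    have hj : j + 1 = 2 * a + 1 := by omega
    push_cast
    rw [zero_add, show Δ ^ (j + 1) = (Δ ^ 2) ^ a * Δ by rw [hj, pow_succ, pow_mul], div_div]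
    exact div_le_div_of_nonneg_left hUw (mul_pos (pow_pos hδ' a) hΔ)
      (mul_le_mul_of_nonneg_right hδa hΔ.le)

/-- The parity test is sufficient: `E < 1 ∧ O² < (1−E)² δ`, `0 < δ ≤ Δ²` ⇒ `E + O/Δ < 1`. -/
theorem ePart_add_oPart_lt_one {d : ℕ} {U wt : ℕ → ℚ} {δ : ℚ} {Δ : ℝ} (hU : ∀ j, j < d → 0 ≤ U (j + 1))
    (hwt : ∀ j, j < d → 0 ≤ wt (j + 1)) (hδ : 0 < δ) (hΔ : 0 < Δ) (hδΔ : (δ : ℝ) ≤ Δ ^ 2)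
    (htest : eoTest d U wt δ = true) :
    (ePart d U wt δ : ℝ) + (oPart d U wt δ : ℝ) / Δ < 1 := by
  unfold eoTest at htest
  simp only [Bool.and_eq_true, decide_eq_true_eq] at htest
  obtain ⟨hE, hO⟩ := htest
  set E := ePart d U wt δ
  set O := oPart d U wt δ
  have hO0 : 0 ≤ O := oPart_nonneg hU hwt hδ
  have hE' : (E : ℝ) < 1 := by exact_mod_cast hE
  have hδ' : (0 : ℝ) < (δ : ℝ) := by exact_mod_cast hδ
  have hsq : Real.sqrt (δ : ℝ) ≤ Δ := by
    calc Real.sqrt (δ : ℝ) ≤ Real.sqrt (Δ ^ 2) := Real.sqrt_le_sqrt hδΔ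
      _ = Δ := Real.sqrt_sq hΔ.le
  have hsqpos : 0 < Real.sqrt (δ : ℝ) := Real.sqrt_pos.mpr hδ'
  have hO' : (O : ℝ) < (1 - (E : ℝ)) * Real.sqrt (δ : ℝ) := by
    have h1 : (0 : ℝ) ≤ (1 - (E : ℝ)) * Real.sqrt (δ : ℝ) := mul_nonneg (by linarith) hsqpos.le
    have h2 : (O : ℝ) ^ 2 < ((1 - (E : ℝ)) * Real.sqrt (δ : ℝ)) ^ 2 := by
      rw [mul_pow, Real.sq_sqrt hδ'.le]; exact_mod_cast hO
    exact lt_of_pow_lt_pow_left₀ 2 h1 h2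
  have hOΔ : (O : ℝ) / Δ ≤ (O : ℝ) / Real.sqrt (δ : ℝ) :=
    div_le_div_of_nonneg_left (by exact_mod_cast hO0) hsqpos hsq
  have : (O : ℝ) / Real.sqrt (δ : ℝ) < 1 - (E : ℝ) := by rwa [div_lt_iff₀ hsqpos]
  linarith


end Summit.RiemannHypothesis.RiemannHypothesis.Theorems.JensenPolynomials.CoeffTable
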